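import Mathlib
import Summits.Ventures.Crystal3D.Theorems.StickyWulffConstantLayerChainDefs
import Summits.Ventures.Crystal3D.Theorems.StickyWulffConstantStackingLiminfLayerChainV4Defs
import Summits.Ventures.Crystal3D.Theorems.StickyWulffConstantStackingLiminfMollifierSmooth
import Summits.Ventures.Crystal3D.Theorems.StickyWulffConstantStackingLiminfKernelBounds
import Summits.Ventures.Crystal3D.Theorems.StickyWulffConstantStackingLiminfModulatedWulff
import Summits.Ventures.Crystal3D.Theorems.StickyWulffConstantStackingLiminfLateralCalculus
import Summits.Ventures.Crystal3D.Theorems.StickyWulffConstantStackingLiminfEtaGradient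
import Summits.Ventures.Crystal3D.Theorems.StickyWulffConstantStackingLiminfLayerSplit
import Summits.Ventures.Crystal3D.Theorems.StickyWulffConstantStackingLiminfPairingBound
import Summits.Ventures.Crystal3D.Theorems.StickyWulffConstantStackingLiminfClassReduction
import HarnessLib

/-!
# The skew term of the two-phase pairing (stub (B) `MollifiedUpper`, line LayerChain v4, crux
# `StackingLiminf`, stmt-Ventures-19145): `T3 ≤ (C_η ‖c‖ / L) · ‖E‖₁`

Cell `crystal3d-full`, venture `Summits/Ventures/Crystal3D`.  BLUEPRINT-v4B (S3), skew part, in the kernel.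
For two index sets `T₁` (the `−1`-phase layers) and `T₂` (all layers) of a configuration `x`, their layer
densities `V = Σ_{i∈T₁} φ_K(· − x_i)`, `v = Σ_{i∈T₂} φ_K(· − x_i)`, lateral averages `W = η_L ∗_∥ V`,
`w = η_L ∗_∥ v`, a height profile `g`, and a HORIZONTAL direction `c` (`c₂ = 0`):
* `skew_apply_eq` — `−DW(y)c + g(y₂)·Dw(y)c = −∫ Dη_L(z)(c₀,c₁) · E(y − ιz) dz` with the skew density
  `E(y') = V(y') − g(y'₂) v(y')` (the derivative falls on the kernel: `fderiv_lateral_apply_of_horizontal`;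
  the height `y₂` is unchanged by lateral shifts, so NO derivative of `g` appears);
* `integral_abs_skew_le` — hence `∫ |−DW(y)c + g(y₂)Dw(y)c| dy ≤ (∫|Dη_L(·)(c₀,c₁)|) · ‖E‖₁`
  (`integral_abs_lateral_le`), and `∫|Dη_L(·)(c₀,c₁)| ≤ C_η ‖(c₀,c₁)‖ / L` (`exists_eta_grad_const`);
WHAT THIS IS NOT: stub (B) (the bound on `‖E‖₁` is S4); rung F-C1 not moved.
-/

noncomputable section

namespace Summit.Ventures.Crystal3D.Theorems

open MeasureTheory Set Function Metric Filter Topology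
open Summit.Ventures.Crystal3D.LayerChain (dot3 aVec bPlus bMinus)
open Summit.Ventures.Crystal3D.Cruxes.StackingLiminf.LayerChainV4 (bump eta negGrad)

variable {N : ℕ}

/-- The height coordinate is unchanged by a lateral shift. -/
theorem lateral_shift_apply_two (y : Fin 3 → ℝ) (z : ℝ × ℝ) :
    (fun j => y j - (![z.1, z.2, 0] : Fin 3 → ℝ) j) 2 = y 2 := by
  simp

/-- **The skew term as a lateral integral against the kernel's gradient.** -/
theorem skew_apply_eq (x : Fin N → EuclideanSpace ℝ (Fin 3)) {K L : ℝ} (hK : 0 < K) (hL : 0 < L)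
    (T₁ T₂ : Finset (Fin N)) (g : ℝ → ℝ) {c : Fin 3 → ℝ} (hc : c 2 = 0) (y : Fin 3 → ℝ) :
    -(fderiv ℝ (fun y : Fin 3 → ℝ => ∫ z : ℝ × ℝ, eta L z *
          ∑ i ∈ T₁, bump K ((fun j => y j - (![z.1, z.2, 0] : Fin 3 → ℝ) j) - WithLp.ofLp (x i))) y c) +
      g (y 2) * fderiv ℝ (fun y : Fin 3 → ℝ => ∫ z : ℝ × ℝ, eta L z *
          ∑ i ∈ T₂, bump K ((fun j => y j - (![z.1, z.2, 0] : Fin 3 → ℝ) j) - WithLp.ofLp (x i))) y c =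
    -∫ z : ℝ × ℝ, fderiv ℝ (eta L) z (c 0, c 1) * ((fun y' : Fin 3 → ℝ =>
        (∑ i ∈ T₁, bump K (y' - WithLp.ofLp (x i))) - g (y' 2) * ∑ i ∈ T₂, bump K (y' - WithLp.ofLp (x i)))
      (fun j => y j - (![z.1, z.2, 0] : Fin 3 → ℝ) j)) := by
  have hη : ContDiff ℝ 1 (eta L) := (contDiff_eta L).of_le (by norm_num)
  have hηs : HasCompactSupport (eta L) := PlateauHeight.hasCompactSupport_eta hL
  have h1 := fderiv_lateral_apply_of_horizontal (eta L) hη hηs _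
    ((contDiff_layerSum x K T₁).of_le (by norm_num)) (hasCompactSupport_layerSum x hK T₁) y c hc
  have h2 := fderiv_lateral_apply_of_horizontal (eta L) hη hηs _
    ((contDiff_layerSum x K T₂).of_le (by norm_num)) (hasCompactSupport_layerSum x hK T₂) y c hc
  -- integrability of the two kernel-gradient integrands
  have hκc : Continuous fun z : ℝ × ℝ => fderiv ℝ (eta L) z (c 0, c 1) :=
    (hη.continuous_fderiv (by norm_num)).clm_apply continuous_const
  have hι : Continuous fun z : ℝ × ℝ => (fun j => y j - (![z.1, z.2, 0] : Fin 3 → ℝ) j) :=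
    continuous_pi fun j => by fin_cases j <;> simp <;> fun_prop
  have hint : ∀ T : Finset (Fin N), Integrable fun z : ℝ × ℝ => fderiv ℝ (eta L) z (c 0, c 1) *
      ∑ i ∈ T, bump K ((fun j => y j - (![z.1, z.2, 0] : Fin 3 → ℝ) j) - WithLp.ofLp (x i)) := by
    intro T
    refine (hκc.mul ((contDiff_layerSum x K T).continuous.comp hι)).integrable_of_hasCompactSupport ?_
    exact (hηs.fderiv_apply (𝕜 := ℝ) (c 0, c 1)).mul_right
  -- the `T₁`/`T₂` functions in the form of the lemma
  have e1 : (fun y : Fin 3 → ℝ => ∫ z : ℝ × ℝ, eta L z *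
      ∑ i ∈ T₁, bump K ((fun j => y j - (![z.1, z.2, 0] : Fin 3 → ℝ) j) - WithLp.ofLp (x i))) =
      fun y => ∫ z : ℝ × ℝ, eta L z * (fun y' : Fin 3 → ℝ => ∑ i ∈ T₁, bump K (y' - WithLp.ofLp (x i)))
        (fun j => y j - (![z.1, z.2, 0] : Fin 3 → ℝ) j) := rfl
  have e2 : (fun y : Fin 3 → ℝ => ∫ z : ℝ × ℝ, eta L z *
      ∑ i ∈ T₂, bump K ((fun j => y j - (![z.1, z.2, 0] : Fin 3 → ℝ) j) - WithLp.ofLp (x i))) =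
      fun y => ∫ z : ℝ × ℝ, eta L z * (fun y' : Fin 3 → ℝ => ∑ i ∈ T₂, bump K (y' - WithLp.ofLp (x i)))
        (fun j => y j - (![z.1, z.2, 0] : Fin 3 → ℝ) j) := rfl
  rw [e1, e2, h1, h2]
  have hG : Integrable fun z : ℝ × ℝ => g (y 2) * (fderiv ℝ (eta L) z (c 0, c 1) *
      ∑ i ∈ T₂, bump K ((fun j => y j - (![z.1, z.2, 0] : Fin 3 → ℝ) j) - WithLp.ofLp (x i))) :=
    (hint T₂).const_mul _
  have hsplit : (∫ z : ℝ × ℝ, fderiv ℝ (eta L) z (c 0, c 1) * ((fun y' : Fin 3 → ℝ =>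
        (∑ i ∈ T₁, bump K (y' - WithLp.ofLp (x i))) - g (y' 2) * ∑ i ∈ T₂, bump K (y' - WithLp.ofLp (x i)))
      (fun j => y j - (![z.1, z.2, 0] : Fin 3 → ℝ) j))) =
      ∫ z : ℝ × ℝ, (fderiv ℝ (eta L) z (c 0, c 1) *
          ∑ i ∈ T₁, bump K ((fun j => y j - (![z.1, z.2, 0] : Fin 3 → ℝ) j) - WithLp.ofLp (x i)) -
        g (y 2) * (fderiv ℝ (eta L) z (c 0, c 1) *
          ∑ i ∈ T₂, bump K ((fun j => y j - (![z.1, z.2, 0] : Fin 3 → ℝ) j) - WithLp.ofLp (x i)))) := by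
    refine integral_congr_ae (Eventually.of_forall fun z => ?_)
    simp only [lateral_shift_apply_two]
    ring
  rw [hsplit, integral_sub (hint T₁) hG, integral_const_mul]
  ring

/-- The skew density `E = V − g(·₂) v` is continuous for continuous `g`. -/
theorem continuous_skewDensity (x : Fin N → EuclideanSpace ℝ (Fin 3)) (K : ℝ) (T₁ T₂ : Finset (Fin N))
    {g : ℝ → ℝ} (hg : Continuous g) :
    Continuous fun y' : Fin 3 → ℝ =>
      (∑ i ∈ T₁, bump K (y' - WithLp.ofLp (x i))) - g (y' 2) * ∑ i ∈ T₂, bump K (y' - WithLp.ofLp (x i)) :=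
  (contDiff_layerSum x K T₁).continuous.sub
    ((hg.comp (continuous_apply 2)).mul (contDiff_layerSum x K T₂).continuous)

/-- The skew density has compact support. -/
theorem hasCompactSupport_skewDensity (x : Fin N → EuclideanSpace ℝ (Fin 3)) {K : ℝ} (hK : 0 < K)
    (T₁ T₂ : Finset (Fin N)) (g : ℝ → ℝ) :
    HasCompactSupport fun y' : Fin 3 → ℝ =>
      (∑ i ∈ T₁, bump K (y' - WithLp.ofLp (x i))) - g (y' 2) * ∑ i ∈ T₂, bump K (y' - WithLp.ofLp (x i)) :=
  (hasCompactSupport_layerSum x hK T₁).sub ((hasCompactSupport_layerSum x hK T₂).mul_left)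

/-- **`L¹` bound of the skew term**: `∫ |−DW(y)c + g(y₂)Dw(y)c| dy ≤ (∫|Dη_L(z)(c₀,c₁)| dz) · ‖E‖₁`. -/
theorem integral_abs_skew_le (x : Fin N → EuclideanSpace ℝ (Fin 3)) {K L : ℝ} (hK : 0 < K) (hL : 0 < L)
    (T₁ T₂ : Finset (Fin N)) {g : ℝ → ℝ} (hg : Continuous g) {c : Fin 3 → ℝ} (hc : c 2 = 0) :
    ∫ y : Fin 3 → ℝ,
      |-(fderiv ℝ (fun y : Fin 3 → ℝ => ∫ z : ℝ × ℝ, eta L z *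
          ∑ i ∈ T₁, bump K ((fun j => y j - (![z.1, z.2, 0] : Fin 3 → ℝ) j) - WithLp.ofLp (x i))) y c) +
        g (y 2) * fderiv ℝ (fun y : Fin 3 → ℝ => ∫ z : ℝ × ℝ, eta L z *
          ∑ i ∈ T₂, bump K ((fun j => y j - (![z.1, z.2, 0] : Fin 3 → ℝ) j) - WithLp.ofLp (x i))) y c| ≤
      (∫ z : ℝ × ℝ, |fderiv ℝ (eta L) z (c 0, c 1)|) *
        ∫ y' : Fin 3 → ℝ, |(∑ i ∈ T₁, bump K (y' - WithLp.ofLp (x i))) -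
          g (y' 2) * ∑ i ∈ T₂, bump K (y' - WithLp.ofLp (x i))| := by
  simp_rw [skew_apply_eq x hK hL T₁ T₂ g hc, abs_neg]
  have hη : ContDiff ℝ 1 (eta L) := (contDiff_eta L).of_le (by norm_num)
  have hκc : Continuous fun z : ℝ × ℝ => fderiv ℝ (eta L) z (c 0, c 1) :=
    (hη.continuous_fderiv (by norm_num)).clm_apply continuous_const
  have hκs : HasCompactSupport fun z : ℝ × ℝ => fderiv ℝ (eta L) z (c 0, c 1) :=
    (PlateauHeight.hasCompactSupport_eta hL).fderiv_apply (𝕜 := ℝ) (c 0, c 1)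
  have hprod := integrable_lateral_integrand (fun z : ℝ × ℝ => fderiv ℝ (eta L) z (c 0, c 1)) hκc hκs
    _ (continuous_skewDensity x K T₁ T₂ hg) (hasCompactSupport_skewDensity x hK T₁ T₂ g)
  exact integral_abs_lateral_le (fun z : ℝ × ℝ => fderiv ℝ (eta L) z (c 0, c 1))
    (fun y' : Fin 3 → ℝ => (∑ i ∈ T₁, bump K (y' - WithLp.ofLp (x i))) -
      g (y' 2) * ∑ i ∈ T₂, bump K (y' - WithLp.ofLp (x i))) hprod

end Summit.Ventures.Crystal3D.Theorems

end
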